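import Summits.Ventures.GridStability.Lyapunov.RelativeLffClosedFormLines
import Summits.Ventures.GridStability.Lyapunov.NE39LLffOsoRoa
import HarnessLib

/-!
# GridStability/Lyapunov/NE39LLffLevel — LFF P2 with EXPLICIT RATIONAL LEVELS: «NE39L» closed form
# (every λ) and the certificate of record (λ = 1/10)

Cell `gridfusion` (LADDER-GRIDFUSION), LFF lane «explicit rational level» (model-1 02:56:21Z p491061
`Models/LineAngleBounds.lean`; model-4 03:02:05Z level blocks `bench/data/NE39/lff-NE39L-h12-level.json`
a868bfb516e4f15a — orientation only, the tables below are re-derived and KERNEL-CHECKED); seat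
gridfusion-lyap-1 (g3); namespace `Summit.Ventures.GridStability.Lyapunov.NE39LLff` (continued).
LABEL OF EVERY MENTION: «synthetic VARIANT (conductances dropped, lossless REDISPATCH at the printed
operating angles), not a sentence about the printed New England system»; tokens MV-2L + MV-RD + MV-λ + MV-h12.

CERTIFIED HERE (kernel, `decide` over `ℚ`): node-angle tables `lo ≤ θ*_i ≤ hi` (width ≤ 4·10⁻⁵ rad) via
model-1's decidable enclosure tests; ONE rational per certificate below every line's level functional
(`RelativeLff.levelBoundQ`): `L_U = −16811/250 = −67.244` for the closed form on the 45-line presentation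
(weights `C_ij`; `−Σ C·eqTermHi ≈ −67.695`, best gap line (1,8)), and `L_oso = −58427/125 = −467.416` for
the certificate of record (weights `K` of cedb541c3cce88c7; sos-4's float `level_c_sup ≈ −467.41`).
CONSEQUENCES: `levelU_roa` / `levelU_synchronisation` — for EVERY `λ > 0` and EVERY `c₀ < (2/λ + λ/2)·L_U`
(e.g. `λ = 1/10`: `c₀ < −1348.2422`) the set `{x ∈ 𝒫 | V_λ x ≤ c₀}` of the closed-form certificate `certU lam`
is positively invariant, every global solution from it tends to `0`, and every solution of
`NE39L.data.toModelRel lam a′` starting in it synchronises with machine `0`; `oso_level_roa` /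
`oso_level_synchronisation` — the same for the certificate OF RECORD with EVERY `c₀ < −467.416`.
THREE COLUMNS. CERTIFIED: the rational facts and the four sentences, for MODEL M′. MODELLED: M′ as in
`NE39LLffRoa` / `NE39LLffOsoRoa`. VALIDATED: nothing. No sentence of this file says that the New England
system or any grid is stable. Definitions: tables `lo`, `hi`, constants `L_U`, `L_oso`, `certU`; no named
fact; standard axioms.
-/

noncomputable section

open Set Filter Topology Real
open Literature.MathematicalPhysics.PowerSystems
open Literature.MathematicalPhysics.PowerSystems.LyapunovFunctionFamily
open Literature.MathematicalPhysics.PowerSystems.ClassicalModel.LosslessSystem (vtGap)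
open Summit.Ventures.GridStability.Models
open Summit.Ventures.GridStability.Lyapunov.RelativeLff

namespace Summit.Ventures.GridStability.Lyapunov.NE39LLff

/-! ### Certified node-angle tables -/

/-- Lower node table `lo_i ≤ θ*_i` (rationals on the `10⁻⁵` grid; machine `0` is the reference, `θ*_0 = 0`). -/
def lo : Fin 10 → ℚ :=
  ![0, 41173 / 100000, 2421 / 5000, 24013 / 50000, 5853 / 12500, 302 / 625, 9861 / 20000,
    44089 / 100000, 16861 / 25000, 3839 / 50000]

/-- Upper node table `θ*_i ≤ hi_i`. -/
def hi : Fin 10 → ℚ :=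
  ![0, 5147 / 12500, 48423 / 100000, 48029 / 100000, 46827 / 100000, 48323 / 100000, 12327 / 25000,
    11023 / 25000, 8431 / 12500, 7681 / 100000]

/-- Every `lo_i` passes model-1's decidable lower test (or is `≤ 0`). -/
theorem lo_test : ∀ i, lo i ≤ 0 ∨ AngleEnclosure.lowerTest (NE39L.data.c i) (lo i) = true := by
  decide +kernel

/-- Every `hi_i` passes model-1's decidable upper test (or dominates the reference node). -/
theorem hi_test : ∀ i, (NE39L.data.c i = 1 ∧ 0 ≤ hi i) ∨
    AngleEnclosure.upperTest (NE39L.data.c i) (hi i) = true := by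
  decide +kernel

/-- Hence `lo_i ≤ θ*_i`. -/
theorem lo_le_angleOf (i : Fin 10) : ((lo i : ℚ) : ℝ) ≤ NE39L.data.angleOf i :=
  NE39L.data.table_le_angleOf NE39L.data_circle.1 acute.1 lo lo_test i

/-- … and `θ*_i ≤ hi_i`. -/
theorem angleOf_le_hi (i : Fin 10) : NE39L.data.angleOf i ≤ ((hi i : ℚ) : ℝ) :=
  NE39L.data.angleOf_le_table NE39L.data_circle.1 acute.1 hi hi_test i

/-! ### Closed form on the 45-line presentation, explicit level (every λ) -/

/-- The level constant of the closed form: `L_U = −67.244`. -/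
def L_U : ℚ := -16811 / 250

/-- `L_U` lies below every line's rational level functional (weights `C_ij`). -/
theorem L_U_le : ∀ k, L_U ≤ levelBoundQ NE39L.data (wuq NE39L.data) lo hi k := by
  decide +kernel

/-- The closed-form certificate of `NE39L` on the 45-line presentation `NE39L.lffSystemU lam`, every
`λ > 0` (`ν = 1/10`; Sherman–Morrison `N⁻¹`). [cite: VuTuritsyn2016, §III eq. (QKH)] -/
def certU (lam : ℚ) (hlam : 0 < lam) :=
  RelativeLff.certU NE39L.data lam hlam NE39L.data.angleOf (ν := 1 / 10) (by norm_num) M_pos nu_lt_Mμ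
    cs_criterion NE39L.data_Cc_pos

/-- **Explicit-level region, closed form, every `λ > 0`**: for every `c₀ < (2/λ + λ/2)·L_U` and every
`y ∈ 𝒫` with `V_λ y ≤ c₀`: a global solution of `NE39L.lffSystemU lam` exists and EVERY global solution
keeps `{𝒫, V_λ ≤ c₀}` and tends to `0`. MODELLED: synthetic lossless redispatched uniform-λ variant.
[cite: VuTuritsyn2016, §IV set ℛ] -/
theorem levelU_roa (lam : ℚ) (hlam : 0 < lam) {c₀ : ℝ}
    (hc₀ : c₀ < (2 / (lam : ℝ) + (lam : ℝ) / 2) * (L_U : ℝ)) {y : Fin 9 ⊕ Fin 9 → ℝ}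
    (hy : y ∈ (NE39L.data.lffSystemU lam NE39L.data.angleOf).polytope)
    (hyc : (certU lam hlam).V y ≤ c₀) :
    (∃ X : ℝ → Fin 9 ⊕ Fin 9 → ℝ, X 0 = y ∧
        ∀ T : ℝ, ∀ t ∈ Icc 0 T, HasDerivWithinAt X
          ((NE39L.data.lffSystemU lam NE39L.data.angleOf).field (X t)) (Icc 0 T) t) ∧
      ∀ X : ℝ → Fin 9 ⊕ Fin 9 → ℝ, X 0 = y →
        (∀ T : ℝ, ∀ t ∈ Icc 0 T, HasDerivWithinAt X
          ((NE39L.data.lffSystemU lam NE39L.data.angleOf).field (X t)) (Icc 0 T) t) →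
        (∀ t, 0 ≤ t → X t ∈ (NE39L.data.lffSystemU lam NE39L.data.angleOf).polytope ∧
            (certU lam hlam).V (X t) ≤ c₀) ∧
          Tendsto X atTop (𝓝 0) :=
  wellU_subset_regionOfAttraction_of_level NE39L.data lam hlam _ M_pos nu_lt_Mμ cs_criterion
    NE39L.data_Cc_pos NE39L.data_eqData NE39L.data_circle.1 acute.1 acute.2 lo hi lo_test hi_test
    L_U_le hc₀ hy hyc

/-- **Explicit-level synchronisation, closed form, every `λ > 0`**, read on `NE39L.data.toModelRel lam a′`
(hypothesis-free: lossless, reciprocal, exact A1 data): every solution whose initial relative state lies in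
`{𝒫, V_λ ≤ c₀}`, `c₀ < (2/λ + λ/2)·L_U`, keeps it and has `(δ_m − δ_0) − (θ*_m − θ*_0) → 0`, `ω_m − ω_0 → 0`.
[cite: VuTuritsyn2016, §IV set ℛ; SauerPai1998, §6.10] -/
theorem levelU_synchronisation (lam : ℚ) (hlam : 0 < lam) (a : ℝ) {c₀ : ℝ}
    (hc₀ : c₀ < (2 / (lam : ℝ) + (lam : ℝ) / 2) * (L_U : ℝ)) {c : ℝ → ClassicalSwing.State 10}
    (hsol : (NE39L.data.toModelRel lam a).IsSolutionOn c univ)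
    (hy : RecastData.lffState NE39L.data.angleOf (c 0) ∈
      (NE39L.data.lffSystemU lam NE39L.data.angleOf).polytope)
    (hyc : (certU lam hlam).V (RecastData.lffState NE39L.data.angleOf (c 0)) ≤ c₀) :
    (∀ t, 0 ≤ t → RecastData.lffState NE39L.data.angleOf (c t) ∈
          (NE39L.data.lffSystemU lam NE39L.data.angleOf).polytope ∧
          (certU lam hlam).V (RecastData.lffState NE39L.data.angleOf (c t)) ≤ c₀) ∧
      Tendsto (fun t => RecastData.lffState NE39L.data.angleOf (c t)) atTop (𝓝 0) :=
  synchronisationU_of_level NE39L.data lam hlam a NE39L.data_transferConductance_eq_zero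
    NE39L.data_B_symm _ M_pos nu_lt_Mμ cs_criterion NE39L.data_Cc_pos NE39L.data_eqData
    NE39L.data_circle.1 acute.1 acute.2 lo hi lo_test hi_test L_U_le hc₀ hsol hy hyc

/-! ### The certificate of record (λ = 1/10), explicit level -/

/-- The level constant of the certificate of record: `L_oso = −467.416`. -/
def L_oso : ℚ := -58427 / 125

/-- `L_oso` lies below every line's rational level functional (weights `K` of the certificate of record). -/
theorem L_oso_le : ∀ k, L_oso ≤ levelBoundQ NE39L.data NE39LLffOso.Kq lo hi k := by
  decide +kernel

/-- The symbolic level hypothesis of `NE39LLffOso.cert` holds for every `c₀ < L_oso`. -/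
theorem oso_hc₀ {c₀ : ℝ} (hc₀ : c₀ < (L_oso : ℝ)) (k : RecastData.LffLine 9) :
    c₀ < NE39LLffOso.cert.V 0 + NE39LLffOso.K k * vtGap (RecastData.lffδsu NE39L.data.angleOf k) := by
  have h := lt_gapLevel_of_level NE39L.data NE39L.data_eqData acute.2 lo_le_angleOf angleOf_le_hi
    NE39LLffOso.Kq NE39LLffOso.Kq_nonneg one_pos L_oso_le (c₀ := c₀) (by simpa using hc₀) k
  rw [Certificate.V_zero]
  simp only [one_mul] at h
  exact h

/-- **Explicit-level region of the certificate OF RECORD** (cedb541c3cce88c7, `λ = 1/10`): for every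
`c₀ < −467.416` and every `y ∈ 𝒫` with `V y ≤ c₀`, a global solution of `NE39L.lffSystemU (1/10)` exists and
EVERY global solution keeps `{𝒫, V ≤ c₀}` and tends to `0`. [cite: VuTuritsyn2016, §IV set ℛ] -/
theorem oso_level_roa {c₀ : ℝ} (hc₀ : c₀ < (L_oso : ℝ)) {y : Fin 9 ⊕ Fin 9 → ℝ}
    (hy : y ∈ (NE39L.lffSystemU (1 / 10)).polytope) (hyc : NE39LLffOso.cert.V y ≤ c₀) :
    (∃ X : ℝ → Fin 9 ⊕ Fin 9 → ℝ, X 0 = y ∧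
        ∀ T : ℝ, ∀ t ∈ Icc 0 T,
          HasDerivWithinAt X ((NE39L.lffSystemU (1 / 10)).field (X t)) (Icc 0 T) t) ∧
      ∀ X : ℝ → Fin 9 ⊕ Fin 9 → ℝ, X 0 = y →
        (∀ T : ℝ, ∀ t ∈ Icc 0 T,
          HasDerivWithinAt X ((NE39L.lffSystemU (1 / 10)).field (X t)) (Icc 0 T) t) →
        (∀ t, 0 ≤ t → X t ∈ (NE39L.lffSystemU (1 / 10)).polytope ∧ NE39LLffOso.cert.V (X t) ≤ c₀) ∧
          Tendsto X atTop (𝓝 0) :=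
  NE39LLffOso.oso_well_subset_regionOfAttraction (oso_hc₀ hc₀) hy hyc

/-- **Explicit-level synchronisation of the certificate OF RECORD**, read on `NE39L.data.toModelRel (1/10) a′`.
[cite: VuTuritsyn2016, §IV set ℛ; SauerPai1998, §6.10] -/
theorem oso_level_synchronisation (a : ℝ) {c₀ : ℝ} (hc₀ : c₀ < (L_oso : ℝ))
    {c : ℝ → ClassicalSwing.State 10} (hsol : (NE39L.data.toModelRel (1 / 10) a).IsSolutionOn c univ)
    (hy : RecastData.lffState NE39L.data.angleOf (c 0) ∈ (NE39L.lffSystemU (1 / 10)).polytope)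
    (hyc : NE39LLffOso.cert.V (RecastData.lffState NE39L.data.angleOf (c 0)) ≤ c₀) :
    (∀ t, 0 ≤ t →
        RecastData.lffState NE39L.data.angleOf (c t) ∈ (NE39L.lffSystemU (1 / 10)).polytope ∧
          NE39LLffOso.cert.V (RecastData.lffState NE39L.data.angleOf (c t)) ≤ c₀) ∧
      Tendsto (fun t => RecastData.lffState NE39L.data.angleOf (c t)) atTop (𝓝 0) :=
  NE39LLffOso.synchronisation_of_isSolutionOn a (oso_hc₀ hc₀) hsol hy hyc

end Summit.Ventures.GridStability.Lyapunov.NE39LLff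

end
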